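import Literature.Analysis.FluidPDE.HardSphereUniqueness
import Literature.Analysis.FluidPDE.HardSphereFlowOrbits
import HarnessLib

/-!
# Relabelling invariance of Alexander's hard-sphere flow construction on good data
(CIP 1994 App. 4.A; GST 2013 Prop. 4.1.1; trunk T-KINETIC, topic Analysis/FluidPDE.)

The construction `Alexander.collisionStep` / `stateAfter` / `collisionInstant` / `FwdGood` /
`good` of `HardSphereFlowConstruction` resolves, at each free exit, *the* incoming pair of a
simple incoming exit configuration. On forward-good data every exit configuration is simple, so
the construction commutes with every relabelling `σ` of the particles:

* `freeExitTime_comp_perm`, `isSimpleIncomingWith_comp_perm`, `collisionStep_comp_perm`;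
* `stateAfter_comp_perm`, `collisionInstant_comp_perm`, `collisionCount_comp_perm` (on `FwdGood` data);
* `fwdGood_comp_perm_iff`, `comp_perm_mem_good_iff` — the forward-good set and the good set are
  invariant under relabelling (for a hard-sphere-regular geometry).

Theorems only; no definition and no named fact is introduced.

## References

* C. Cercignani, R. Illner, M. Pulvirenti, *The Mathematical Theory of Dilute Gases*, Springer
  (1994), App. 4.A.
* I. Gallagher, L. Saint-Raymond, B. Texier, *From Newton to Boltzmann*, EMS (2013), Prop. 4.1.1.
-/

open MeasureTheory Set Filter Topology Function
open scoped ENNReal InnerProductSpace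

namespace Literature.Analysis.FluidPDE

noncomputable section

section Kinetic

variable {d : Type*} [Fintype d] {X : Type*} [TopologicalSpace X] {N : ℕ}

namespace Alexander

variable {G : Geometry d X} {ε : ℝ}

omit [TopologicalSpace X] in
/-- **The free exit time is invariant under relabelling.** [folklore] -/
theorem freeExitTime_comp_perm (σ : Equiv.Perm (Fin N)) (z : Config N d X) :
    freeExitTime G ε (z ∘ σ : Config N d X) = freeExitTime G ε z := by
  unfold freeExitTime
  congr 1
  ext t
  simp only [mem_setOf_eq, freeFlight_comp_perm, perm_mem_hardSphereDomain_iff]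

/-- **Relabelling a simple incoming configuration**: if `z` is simple incoming with pair `p`, then
`z ∘ σ` is simple incoming with the (ordered) pair `{σ⁻¹ p.1, σ⁻¹ p.2}`. [folklore] -/
theorem isSimpleIncomingWith_comp_perm (hG : G.IsHardSphereRegular ε) {z : Config N d X} {p : Fin N × Fin N}
    (hp : IsSimpleIncomingWith G ε z p) (σ : Equiv.Perm (Fin N)) :
    ∃ q : Fin N × Fin N, IsSimpleIncomingWith G ε (z ∘ σ : Config N d X) q ∧
      ({σ q.1, σ q.2} : Finset (Fin N)) = {p.1, p.2} := by
  have hne : σ.symm p.1 ≠ σ.symm p.2 := fun h => hp.ne (σ.symm.injective h)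
  have hcontact : ∀ i j : Fin N, i ≠ j → ((z ∘ σ : Config N d X) ∈ contactSet G N ε i j ↔
      ({σ i, σ j} : Finset (Fin N)) = {p.1, p.2}) := fun i j hij => by
    rw [perm_mem_contactSet_iff]; exact hp.2.2 (σ i) (σ j) (σ.injective.ne hij)
  have hpair : ∀ i j : Fin N, (({σ i, σ j} : Finset (Fin N)) = {p.1, p.2} ↔
      ({i, j} : Finset (Fin N)) = {σ.symm p.1, σ.symm p.2}) := by
    intro i j
    rw [finsetPair_eq_iff, finsetPair_eq_iff]
    constructor
    · rintro (⟨h1, h2⟩ | ⟨h1, h2⟩)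
      · exact Or.inl ⟨by rw [← h1, Equiv.symm_apply_apply], by rw [← h2, Equiv.symm_apply_apply]⟩
      · exact Or.inr ⟨by rw [← h1, Equiv.symm_apply_apply], by rw [← h2, Equiv.symm_apply_apply]⟩
    · rintro (⟨h1, h2⟩ | ⟨h1, h2⟩)
      · exact Or.inl ⟨by rw [h1, Equiv.apply_symm_apply], by rw [h2, Equiv.apply_symm_apply]⟩
      · exact Or.inr ⟨by rw [h1, Equiv.apply_symm_apply], by rw [h2, Equiv.apply_symm_apply]⟩
  have hsep : ‖G.sepVec (z p.1).1 (z p.2).1‖ ≤ ε := (mem_contactSet.1 hp.mem_contactSet).2.le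
  rcases lt_or_gt_of_ne hne with hlt | hgt
  · refine ⟨(σ.symm p.1, σ.symm p.2), ⟨hlt, ?_, fun i j hij => ?_⟩, ?_⟩
    · show IsIncoming G (z ∘ σ : Config N d X) (σ.symm p.1) (σ.symm p.2)
      rw [isIncoming_comp_perm_iff, Equiv.apply_symm_apply, Equiv.apply_symm_apply]
      exact hp.isIncoming
    · rw [hcontact i j hij, hpair]
    · simp only [Equiv.apply_symm_apply]
  · refine ⟨(σ.symm p.2, σ.symm p.1), ⟨hgt, ?_, fun i j hij => ?_⟩, ?_⟩
    · show IsIncoming G (z ∘ σ : Config N d X) (σ.symm p.2) (σ.symm p.1)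
      rw [isIncoming_comp_perm_iff, Equiv.apply_symm_apply, Equiv.apply_symm_apply]
      exact (Geometry.IsHardSphereRegular.isIncoming_comm hG hsep).2 hp.isIncoming
    · rw [hcontact i j hij, hpair, Finset.pair_comm (σ.symm p.2)]
    · simp only [Equiv.apply_symm_apply]; exact Finset.pair_comm _ _

/-- **The collision step commutes with relabelling** when the exit configuration (if any) is
simple incoming. [folklore] -/
theorem collisionStep_comp_perm (hG : G.IsHardSphereRegular ε) {z : Config N d X}
    (hsimple : freeExitTime G ε z ≠ ∞ → IsSimpleIncoming G ε (freeFlight G (freeExitTime G ε z).toReal z))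
    (σ : Equiv.Perm (Fin N)) :
    collisionStep G ε (z ∘ σ : Config N d X) = (collisionStep G ε z ∘ σ : Config N d X) := by
  by_cases htop : freeExitTime G ε z = ∞
  · rw [collisionStep_of_eq_top htop, collisionStep_of_eq_top (by rw [freeExitTime_comp_perm]; exact htop)]
  · obtain ⟨p, hp⟩ := isSimpleIncoming_iff.1 (hsimple htop)
    obtain ⟨q, hq, hqp⟩ := isSimpleIncomingWith_comp_perm hG hp σ
    have htop' : freeExitTime G ε (z ∘ σ : Config N d X) ≠ ∞ := by rw [freeExitTime_comp_perm]; exact htop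
    have hq' : IsSimpleIncomingWith G ε (freeFlight G (freeExitTime G ε (z ∘ σ : Config N d X)).toReal (z ∘ σ : Config N d X)) q := by
      rw [freeExitTime_comp_perm, freeFlight_comp_perm]; exact hq
    rw [collisionStep_eq_collidePair htop' hq', collisionStep_eq_collidePair htop hp, freeExitTime_comp_perm, freeFlight_comp_perm,
      collidePair_comp_perm hq.ne σ]
    congr 1
    rcases finsetPair_eq_iff.1 hqp with ⟨h1, h2⟩ | ⟨h1, h2⟩
    · rw [h1, h2]
    · rw [h1, h2]
      exact Geometry.IsHardSphereRegular.collidePair_comm hG hp.ne (mem_contactSet.1 hp.mem_contactSet).2.le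

/-- **The post-collisional states commute with relabelling** on forward-good data. [folklore] -/
theorem stateAfter_comp_perm (hG : G.IsHardSphereRegular ε) {z : Config N d X} (hz : FwdGood G ε z)
    (σ : Equiv.Perm (Fin N)) (k : ℕ) :
    stateAfter G ε (z ∘ σ : Config N d X) k = (stateAfter G ε z k ∘ σ : Config N d X) := by
  induction k with
  | zero => rfl
  | succ k ih =>
    rw [stateAfter_succ, stateAfter_succ, ih]
    exact collisionStep_comp_perm hG (hz.1 k) σ

/-- **The collision instants are invariant under relabelling** on forward-good data. [folklore] -/
theorem collisionInstant_comp_perm (hG : G.IsHardSphereRegular ε) {z : Config N d X} (hz : FwdGood G ε z)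
    (σ : Equiv.Perm (Fin N)) (k : ℕ) :
    collisionInstant G ε (z ∘ σ : Config N d X) k = collisionInstant G ε z k := by
  unfold collisionInstant
  refine Finset.sum_congr rfl fun m _ => ?_
  rw [stateAfter_comp_perm hG hz σ m, freeExitTime_comp_perm]

/-- **The collision count is invariant under relabelling** on forward-good data. [folklore] -/
theorem collisionCount_comp_perm (hG : G.IsHardSphereRegular ε) {z : Config N d X} (hz : FwdGood G ε z)
    (σ : Equiv.Perm (Fin N)) (t : ℝ) :
    collisionCount G ε (z ∘ σ : Config N d X) t = collisionCount G ε z t := by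
  unfold collisionCount
  simp only [collisionInstant_comp_perm hG hz σ]

/-- **Forward goodness is preserved by relabelling.** [folklore] -/
theorem fwdGood_comp_perm (hG : G.IsHardSphereRegular ε) {z : Config N d X} (hz : FwdGood G ε z)
    (σ : Equiv.Perm (Fin N)) : FwdGood G ε (z ∘ σ : Config N d X) := by
  refine ⟨fun k hk => ?_, fun k t ht htk i j hij => ?_, ?_⟩
  · rw [stateAfter_comp_perm hG hz σ k, freeExitTime_comp_perm] at hk ⊢
    rw [freeFlight_comp_perm]
    obtain ⟨p, hp⟩ := isSimpleIncoming_iff.1 (hz.1 k hk)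
    obtain ⟨q, hq, -⟩ := isSimpleIncomingWith_comp_perm hG hp σ
    exact isSimpleIncoming_iff.2 ⟨q, hq⟩
  · rw [stateAfter_comp_perm hG hz σ k, freeExitTime_comp_perm] at htk
    rw [stateAfter_comp_perm hG hz σ k, freeFlight_comp_perm, perm_mem_contactSet_iff]
    exact hz.2.1 k t ht htk (σ i) (σ j) (σ.injective.ne hij)
  · have h := hz.2.2
    simp only [stateAfter_comp_perm hG hz σ, freeExitTime_comp_perm]
    exact h

/-- **Forward goodness is invariant under relabelling.** [folklore] -/
theorem fwdGood_comp_perm_iff (hG : G.IsHardSphereRegular ε) (σ : Equiv.Perm (Fin N)) (z : Config N d X) :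
    FwdGood G ε (z ∘ σ : Config N d X) ↔ FwdGood G ε z := by
  refine ⟨fun h => ?_, fun h => fwdGood_comp_perm hG h σ⟩
  have h2 := fwdGood_comp_perm hG h σ.symm
  have heq : ((z ∘ σ) ∘ σ.symm : Config N d X) = z := by
    ext1 i; simp
  rwa [heq] at h2

/-- **The good set is invariant under relabelling** (hard-sphere-regular geometry): membership in
Alexander's good set `Γ₀` — hard-sphere domain, the contact clause, forward goodness of `z` and of
`flipVel z` — is preserved by `z ↦ z ∘ σ` for every permutation `σ` of the labels. [folklore] -/
theorem comp_perm_mem_good_iff (hG : G.IsHardSphereRegular ε) (σ : Equiv.Perm (Fin N)) (z : Config N d X) :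
    (z ∘ σ : Config N d X) ∈ good G ε ↔ z ∈ good G ε := by
  suffices key : ∀ (τ : Equiv.Perm (Fin N)) (w : Config N d X), w ∈ good G ε → (w ∘ τ : Config N d X) ∈ good G ε by
    refine ⟨fun h => ?_, key σ z⟩
    have h2 := key σ.symm _ h
    have heq : ((z ∘ σ) ∘ σ.symm : Config N d X) = z := by
      ext1 i; simp
    rwa [heq] at h2
  intro τ w hw
  obtain ⟨hD, hcl, hfg, hbg⟩ := hw
  refine ⟨(perm_mem_hardSphereDomain_iff τ w).2 hD, fun i j hij hc => ?_, fwdGood_comp_perm hG hfg τ, ?_⟩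
  · rw [perm_mem_contactSet_iff] at hc
    obtain ⟨hout, huniq⟩ := hcl (τ i) (τ j) (τ.injective.ne hij) hc
    refine ⟨hout, fun i' j' hij' hc' => ?_⟩
    rw [perm_mem_contactSet_iff] at hc'
    have h := huniq (τ i') (τ j') (τ.injective.ne hij') hc'
    rcases finsetPair_eq_iff.1 h with ⟨h1, h2⟩ | ⟨h1, h2⟩
    · rw [τ.injective h1, τ.injective h2]
    · rw [τ.injective h1, τ.injective h2]; exact Finset.pair_comm _ _
  · have hflip : flipVel (w ∘ τ : Config N d X) = (flipVel w ∘ τ : Config N d X) := rfl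
    rw [hflip]
    exact fwdGood_comp_perm hG hbg τ

end Alexander

end Kinetic

end

end Literature.Analysis.FluidPDE
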